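import Mathlib

/-!
# Real points of a rational polyhedral cone lie in the real span of its rational points

Classical fact about RATIONAL polyhedral cones ([cite: Schrijver1986, §7.2 Cor 7.1a p.87–88] — a polyhedral cone cut
out by rational inequalities is generated by rational vectors; see also §16.2): let `ι` be a finite index set and
`a j : ι → ℚ` (`j ∈ J`, `J` finite) finitely many rational linear forms. If `r : ι → ℝ` satisfies `0 ≤ Σ_i a j i · r i`
for every `j`, then `r` lies in the `ℝ`-linear span of the RATIONAL solutions `q : ι → ℚ` of the same system
(`mem_span_ratCast_of_forall_sum_mul_nonneg`).

The proof given here is the elementary "`ℚ`-basis trick" (no Fourier–Motzkin, no Minkowski–Weyl): choose a `ℚ`-basis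
`w₁, …, w_m ∈ ℝ` of the `ℚ`-span of the coordinates of `r` and write `r = Σ_k w_k · v_k` with `v_k ∈ ℚ^ι`; by the
`ℚ`-linear independence of the `w_k`, a constraint that is ACTIVE at `r` (`Σ_i a j i r i = 0`) vanishes identically on
every `ℝ`-combination `Σ_k u_k v_k`, while the inactive ones (`> 0` at `u = w`) stay positive for `u` in an open
neighbourhood of `w`; rational `u` in that neighbourhood give rational points of the cone, and they span (an open set of
`ℝ^m` is spanned by its rational points — private helper `mem_span_ratCast_of_isOpen`).

Filed for the abc-iut cell (seat abc-iut-w5-d098) as the Mathlib-only half of sub-DAG row «EtTh:Thm3.7(iii)/L10-R»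
(plan/L2/SUBDAG-EtTh-Thm37.md, R3″: transport of [EtTh] Prop 3.4 (ii) to the `Λ = ℝ` data `ofRlfR` —
`b = Σ_i r_i·div(b_i) ∈ ℝ·Φ₀^birat` effective ⇒ `b ∈ ℝ·Φ₀^cnst`, the effective cone being rational polyhedral in `r`).
Pure linear algebra over Mathlib; nothing here bears on [IUTchIII] Cor. 3.12.
-/

namespace Literature.Analysis.Convex.RationalCone

open Finset

/-! ### An open subset of `ℝ^m` is spanned (over `ℝ`) by its rational points -/

/-- Every point of an OPEN subset `U ⊆ ℝ^m` lies in the `ℝ`-span of the rational points of `U`: a small rational box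
around the point contains `u₀` and `u₀ + δ·e_k` (`u₀ ∈ ℚ^m`, `δ ∈ ℚ_{>0}`), whose differences are positive multiples
of the standard basis (private helper). [folklore] -/
private theorem mem_span_ratCast_of_isOpen {m : ℕ} {U : Set (Fin m → ℝ)} (hU : IsOpen U) {w : Fin m → ℝ} (hw : w ∈ U) :
    w ∈ Submodule.span ℝ {v : Fin m → ℝ | v ∈ U ∧ ∃ u : Fin m → ℚ, v = fun k => (u k : ℝ)} := by
  obtain ⟨ε, hε, hball⟩ := Metric.isOpen_iff.mp hU w hw
  -- a rational point `u₀` with `|u₀ k - w k| < ε/2`, and a rational `0 < δ < ε/2`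
  have hex : ∀ k : Fin m, ∃ q : ℚ, w k - ε / 2 < q ∧ (q : ℝ) < w k + ε / 2 := fun k =>
    exists_rat_btwn (by linarith)
  choose u₀ hu₀ using hex
  obtain ⟨δ, hδ0, hδε⟩ := exists_rat_btwn (half_pos hε)
  have hδ0' : (0 : ℚ) < δ := by exact_mod_cast hδ0
  -- the rational points `u₀` and `u₀ + δ e_k` lie in the ball, hence in `U`
  set S : Set (Fin m → ℝ) := {v | v ∈ U ∧ ∃ u : Fin m → ℚ, v = fun k => (u k : ℝ)} with hS
  have mem_ball : ∀ u : Fin m → ℚ, (∀ k, |(u k : ℝ) - w k| < ε) → (fun k => (u k : ℝ)) ∈ U := by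
    intro u hu
    apply hball
    rw [Metric.mem_ball, dist_pi_lt_iff hε]
    intro k
    rw [Real.dist_eq]
    exact hu k
  have h0 : (fun k => (u₀ k : ℝ)) ∈ S := by
    refine ⟨mem_ball u₀ fun k => ?_, u₀, rfl⟩
    rw [abs_sub_lt_iff]; constructor <;> linarith [(hu₀ k).1, (hu₀ k).2]
  have hk : ∀ k : Fin m, (fun k' => ((u₀ + δ • Pi.single k 1 : Fin m → ℚ) k' : ℝ)) ∈ S := by
    intro k
    refine ⟨mem_ball _ fun k' => ?_, _, rfl⟩
    rw [Pi.add_apply, Pi.smul_apply, Rat.cast_add, smul_eq_mul, Rat.cast_mul]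
    by_cases hkk : k' = k
    · subst hkk
      rw [Pi.single_eq_same, Rat.cast_one, mul_one, abs_sub_lt_iff]
      constructor <;> linarith [(hu₀ k').1, (hu₀ k').2]
    · rw [Pi.single_eq_of_ne hkk, Rat.cast_zero, mul_zero, add_zero, abs_sub_lt_iff]
      constructor <;> linarith [(hu₀ k').1, (hu₀ k').2]
  -- every standard basis vector is `δ⁻¹ • ((u₀ + δ e_k) - u₀)`, hence in the span
  have hE : ∀ k : Fin m, (Pi.single k (1 : ℝ) : Fin m → ℝ) ∈ Submodule.span ℝ S := by
    intro k
    have hdiff : (fun k' => ((u₀ + δ • Pi.single k 1 : Fin m → ℚ) k' : ℝ)) - (fun k' => (u₀ k' : ℝ)) =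
        (δ : ℝ) • (Pi.single k (1 : ℝ) : Fin m → ℝ) := by
      funext k'
      rw [Pi.sub_apply, Pi.smul_apply, Pi.add_apply, Pi.smul_apply, Rat.cast_add, smul_eq_mul, Rat.cast_mul,
        smul_eq_mul]
      by_cases hkk : k' = k
      · subst hkk; rw [Pi.single_eq_same, Pi.single_eq_same, Rat.cast_one]; ring
      · rw [Pi.single_eq_of_ne hkk, Pi.single_eq_of_ne hkk, Rat.cast_zero]; ring
    have hmem : (δ : ℝ) • (Pi.single k (1 : ℝ) : Fin m → ℝ) ∈ Submodule.span ℝ S := by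
      rw [← hdiff]
      exact Submodule.sub_mem _ (Submodule.subset_span (hk k)) (Submodule.subset_span h0)
    have hδR : (δ : ℝ) ≠ 0 := by exact_mod_cast hδ0'.ne'
    have := Submodule.smul_mem _ (δ : ℝ)⁻¹ hmem
    rwa [smul_smul, inv_mul_cancel₀ hδR, one_smul] at this
  -- so the span is everything
  have htop : (⊤ : Submodule ℝ (Fin m → ℝ)) ≤ Submodule.span ℝ S := by
    rw [← (Pi.basisFun ℝ (Fin m)).span_eq]
    refine Submodule.span_le.mpr ?_
    rintro _ ⟨k, rfl⟩
    rw [Pi.basisFun_apply]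
    exact hE k
  exact htop Submodule.mem_top

/-! ### The `ℚ`-basis trick -/

/-- `ℚ`-linear independence read in `ℝ`: if reals `w k` are `ℚ`-linearly independent and `Σ_k s_k · w_k = 0` with
RATIONAL `s_k`, then all `s_k = 0` (private helper). [folklore] -/
private theorem eq_zero_of_sum_ratCast_mul_eq_zero {m : ℕ} {w : Fin m → ℝ} (hw : LinearIndependent ℚ w) (s : Fin m → ℚ)
    (h : ∑ k, (s k : ℝ) * w k = 0) : ∀ k, s k = 0 :=
  Fintype.linearIndependent_iff.mp hw s (by simpa only [Rat.smul_def] using h)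

/-- **Real points of a rational polyhedral cone lie in the `ℝ`-span of its rational points.** For finitely many
rational linear forms `a j` (`j ∈ J`) on `ℝ^ι` and `r : ι → ℝ` with `0 ≤ Σ_i a j i · r i` for all `j`, `r` is an
`ℝ`-linear combination of vectors `q : ι → ℚ` with `0 ≤ Σ_i a j i · q i` for all `j`.
[cite: Schrijver1986, §7.2 Cor 7.1a p.87–88] -/
theorem mem_span_ratCast_of_forall_sum_mul_nonneg {ι J : Type*} [Fintype ι] [Finite J] (a : J → ι → ℚ)
    (r : ι → ℝ) (hr : ∀ j, 0 ≤ ∑ i, (a j i : ℝ) * r i) :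
    r ∈ Submodule.span ℝ
      {v : ι → ℝ | ∃ q : ι → ℚ, (∀ j, 0 ≤ ∑ i, a j i * q i) ∧ v = fun i => (q i : ℝ)} := by
  classical
  set C : Set (ι → ℝ) := {v : ι → ℝ | ∃ q : ι → ℚ, (∀ j, 0 ≤ ∑ i, a j i * q i) ∧ v = fun i => (q i : ℝ)}
    with hC
  -- Step 1: a `ℚ`-basis of the `ℚ`-span `W` of the coordinates of `r`
  set W : Submodule ℚ ℝ := Submodule.span ℚ (Set.range r) with hW
  haveI : Module.Finite ℚ W := Module.Finite.span_of_finite ℚ (Set.finite_range r)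
  set m : ℕ := Module.finrank ℚ W with hm
  let b : Module.Basis (Fin m) ℚ W := Module.finBasis ℚ W
  let w : Fin m → ℝ := fun k => (b k : ℝ)
  have hwli : LinearIndependent ℚ w := b.linearIndependent.map' W.subtype (Submodule.ker_subtype W)
  -- Step 2: rational coordinates `lam i k` with `r i = Σ_k lam i k · w k`
  let ri : ι → W := fun i => ⟨r i, Submodule.subset_span ⟨i, rfl⟩⟩
  let lam : ι → Fin m → ℚ := fun i k => b.repr (ri i) k
  have hri : ∀ i, r i = ∑ k, (lam i k : ℝ) * w k := by
    intro i
    have h := congrArg Subtype.val (b.sum_repr (ri i))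
    rw [Submodule.coe_sum] at h
    simp only [Submodule.coe_smul, Rat.smul_def] at h
    exact h.symm
  -- Step 3: the linear map `V u := (Σ_k lam i k · u k)_i`, with `V w = r` and `V(ℚ^m) ⊆ ℚ^ι`
  let M : Matrix ι (Fin m) ℝ := fun i k => (lam i k : ℝ)
  let V : (Fin m → ℝ) →ₗ[ℝ] (ι → ℝ) := Matrix.mulVecLin M
  have hV : ∀ u : Fin m → ℝ, V u = fun i => ∑ k, (lam i k : ℝ) * u k := fun u => rfl
  have hVw : V w = r := by rw [hV]; funext i; exact (hri i).symm
  -- Step 4: the forms on `u`-space: `S j k := Σ_i a j i · lam i k`, `Σ_i a j i (V u)_i = Σ_k S j k u_k`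
  let S : J → Fin m → ℚ := fun j k => ∑ i, a j i * lam i k
  have hsum : ∀ (j : J) (u : Fin m → ℝ), ∑ i, (a j i : ℝ) * (V u) i = ∑ k, (S j k : ℝ) * u k := by
    intro j u
    rw [hV]
    show ∑ i, (a j i : ℝ) * (∑ k, (lam i k : ℝ) * u k) = ∑ k, ((∑ i, a j i * lam i k : ℚ) : ℝ) * u k
    push_cast
    simp only [Finset.mul_sum, Finset.sum_mul, mul_assoc]
    exact Finset.sum_comm
  have hsumQ : ∀ (j : J) (u : Fin m → ℚ), ∑ i, a j i * (∑ k, lam i k * u k) = ∑ k, S j k * u k := by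
    intro j u
    show ∑ i, a j i * (∑ k, lam i k * u k) = ∑ k, (∑ i, a j i * lam i k) * u k
    simp only [Finset.mul_sum, Finset.sum_mul, mul_assoc]
    exact Finset.sum_comm
  -- Step 5: ACTIVE forms vanish identically; inactive ones are positive at `w`
  have hdich : ∀ j, (∀ k, S j k = 0) ∨ 0 < ∑ k, (S j k : ℝ) * w k := by
    intro j
    have h0 : 0 ≤ ∑ k, (S j k : ℝ) * w k := by rw [← hsum j w, hVw]; exact hr j
    rcases h0.lt_or_eq with hlt | heq
    · exact Or.inr hlt
    · exact Or.inl (eq_zero_of_sum_ratCast_mul_eq_zero hwli (S j) heq.symm)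
  -- Step 6: the open neighbourhood `U` of `w` on which every inactive form stays positive
  let U : Set (Fin m → ℝ) := {u | ∀ j, ¬ (∀ k, S j k = 0) → 0 < ∑ k, (S j k : ℝ) * u k}
  have hUopen : IsOpen U := by
    have hU' : U = ⋂ j, {u : Fin m → ℝ | ¬ (∀ k, S j k = 0) → 0 < ∑ k, (S j k : ℝ) * u k} := by
      ext u; simp only [Set.mem_iInter, Set.mem_setOf_eq, U]
    rw [hU']
    refine isOpen_iInter_of_finite fun j => ?_
    by_cases hj : ∀ k, S j k = 0
    · have : {u : Fin m → ℝ | ¬ (∀ k, S j k = 0) → 0 < ∑ k, (S j k : ℝ) * u k} = Set.univ :=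
        Set.eq_univ_of_forall fun u h => (h hj).elim
      rw [this]; exact isOpen_univ
    · have : {u : Fin m → ℝ | ¬ (∀ k, S j k = 0) → 0 < ∑ k, (S j k : ℝ) * u k} =
          {u | 0 < ∑ k, (S j k : ℝ) * u k} := by
        ext u; simp only [Set.mem_setOf_eq]; exact ⟨fun h => h hj, fun h _ => h⟩
      rw [this]
      exact isOpen_lt continuous_const (by fun_prop)
  have hwU : w ∈ U := fun j hj => (hdich j).resolve_left hj
  -- Step 7: rational points of `U` give rational points of the cone under `V`
  have himage : ∀ v ∈ {v : Fin m → ℝ | v ∈ U ∧ ∃ u : Fin m → ℚ, v = fun k => (u k : ℝ)}, V v ∈ C := by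
    rintro _ ⟨hvU, u, rfl⟩
    refine ⟨fun i => ∑ k, lam i k * u k, fun j => ?_, ?_⟩
    · rw [hsumQ]
      rcases hdich j with hj | hj
      · simp only [hj, zero_mul, Finset.sum_const_zero, le_refl]
      · have hpos := hvU j (fun hall => ?_)
        · have : (0 : ℝ) < ((∑ k, S j k * u k : ℚ) : ℝ) := by push_cast; exact hpos
          exact le_of_lt (by exact_mod_cast this)
        · simp only [hall, Rat.cast_zero, zero_mul, Finset.sum_const_zero, lt_self_iff_false] at hj
    · rw [hV]; funext i; push_cast; rfl
  -- Step 8: assemble — `w` is in the span of the rational points of `U`, apply `V`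
  have hwspan := mem_span_ratCast_of_isOpen hUopen hwU
  rw [← hVw]
  have hmap := Submodule.mem_map_of_mem (f := V) hwspan
  rw [Submodule.map_span] at hmap
  refine Submodule.span_mono ?_ hmap
  rintro _ ⟨v, hv, rfl⟩
  exact himage v hv

/-- **The real cone and its rational points span the same `ℝ`-subspace**: for a rational H-cone
`C = {r : ℝ^ι | 0 ≤ a j · r ∀ j}`, `span_ℝ (C ∩ ℚ^ι) = span_ℝ C`. [cite: Schrijver1986, §7.2 Cor 7.1a p.87–88] -/
theorem span_ratCast_eq_span {ι J : Type*} [Fintype ι] [Finite J] (a : J → ι → ℚ) :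
    Submodule.span ℝ {v : ι → ℝ | ∃ q : ι → ℚ, (∀ j, 0 ≤ ∑ i, a j i * q i) ∧ v = fun i => (q i : ℝ)} =
      Submodule.span ℝ {r : ι → ℝ | ∀ j, 0 ≤ ∑ i, (a j i : ℝ) * r i} := by
  refine le_antisymm (Submodule.span_mono ?_) (Submodule.span_le.mpr fun r hr => ?_)
  · rintro _ ⟨q, hq, rfl⟩ j
    have h : ((0 : ℚ) : ℝ) ≤ ((∑ i, a j i * q i : ℚ) : ℝ) := by exact_mod_cast hq j
    simpa only [Rat.cast_zero, Rat.cast_sum, Rat.cast_mul] using h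
  · exact mem_span_ratCast_of_forall_sum_mul_nonneg a r hr

/-- Pointwise form with the constraints as a `Finset` of rational covectors (the shape in which a finite
support set of primes indexes them). [cite: Schrijver1986, §7.2 Cor 7.1a p.87–88] -/
theorem mem_span_ratCast_of_forall_mem_finset {ι : Type*} [Fintype ι] (A : Finset (ι → ℚ)) (r : ι → ℝ)
    (hr : ∀ c ∈ A, 0 ≤ ∑ i, (c i : ℝ) * r i) :
    r ∈ Submodule.span ℝ
      {v : ι → ℝ | ∃ q : ι → ℚ, (∀ c ∈ A, 0 ≤ ∑ i, c i * q i) ∧ v = fun i => (q i : ℝ)} := by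
  have h := mem_span_ratCast_of_forall_sum_mul_nonneg (J := A) (fun c => (c : ι → ℚ)) r fun c => hr c c.2
  refine Submodule.span_mono ?_ h
  rintro _ ⟨q, hq, rfl⟩
  exact ⟨q, fun c hc => hq ⟨c, hc⟩, rfl⟩

/-! ### Appendix (append-only): the CONVEX-HULL form — real points are convex combinations of rational points -/

/-- Every point of an OPEN subset `U ⊆ ℝ^m` is a CONVEX COMBINATION of rational points of `U`: it lies in a small box
with rational corners contained in `U`, and a box is the convex hull of its corners (private helper). [folklore] -/
private theorem mem_convexHull_ratCast_of_isOpen {m : ℕ} {U : Set (Fin m → ℝ)} (hU : IsOpen U) {w : Fin m → ℝ}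
    (hw : w ∈ U) :
    w ∈ convexHull ℝ {v : Fin m → ℝ | v ∈ U ∧ ∃ u : Fin m → ℚ, v = fun k => (u k : ℝ)} := by
  classical
  obtain ⟨ε, hε, hball⟩ := Metric.isOpen_iff.mp hU w hw
  -- rational corners `α k < w k < β k` within `ε/2`
  have hexα : ∀ k : Fin m, ∃ q : ℚ, w k - ε / 2 < q ∧ (q : ℝ) < w k := fun k => exists_rat_btwn (by linarith)
  have hexβ : ∀ k : Fin m, ∃ q : ℚ, w k < q ∧ (q : ℝ) < w k + ε / 2 := fun k => exists_rat_btwn (by linarith)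
  choose α hα using hexα
  choose β hβ using hexβ
  -- the box `Π_k {α k, β k}` (corner set) and its hull
  let T : Fin m → Set ℝ := fun k => {(α k : ℝ), (β k : ℝ)}
  have hwbox : w ∈ convexHull ℝ (Set.univ.pi T) := by
    refine mem_convexHull_pi fun k _ => ?_
    rw [convexHull_pair, segment_eq_Icc (le_of_lt ((hα k).2.trans (hβ k).1))]
    exact ⟨le_of_lt (hα k).2, le_of_lt (hβ k).1⟩
  -- every corner is a rational point of `U`
  have hcorner : Set.univ.pi T ⊆ {v : Fin m → ℝ | v ∈ U ∧ ∃ u : Fin m → ℚ, v = fun k => (u k : ℝ)} := by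
    intro v hv
    have hvk : ∀ k, v k = (α k : ℝ) ∨ v k = (β k : ℝ) := fun k => by
      simpa [T, Set.mem_insert_iff, Set.mem_singleton_iff] using hv k (Set.mem_univ k)
    refine ⟨hball ?_, fun k => if v k = (α k : ℝ) then α k else β k, funext fun k => ?_⟩
    · rw [Metric.mem_ball, dist_pi_lt_iff hε]
      intro k
      rw [Real.dist_eq]
      rcases hvk k with h | h <;> rw [h, abs_sub_lt_iff] <;> constructor <;>
        linarith [(hα k).1, (hα k).2, (hβ k).1, (hβ k).2]
    · show v k = ((if v k = (α k : ℝ) then α k else β k : ℚ) : ℝ)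
      by_cases h : v k = (α k : ℝ)
      · rw [if_pos h]; exact h
      · rw [if_neg h]; exact (hvk k).resolve_left h
  exact convexHull_mono hcorner hwbox

/-- **Real points of a rational polyhedral cone are CONVEX COMBINATIONS of its rational points** (hence lie in the
`ℝ≥0`-cone and in the `ℝ`-span they generate): for finitely many rational linear forms `a j` on `ℝ^ι` and
`r : ι → ℝ` with `0 ≤ Σ_i a j i · r i` for all `j`, `r ∈ convexHull ℝ {q ∈ ℚ^ι | ∀ j, 0 ≤ Σ_i a j i · q i}`.
This is the rational-generation statement behind [cite: Schrijver1986, §7.2 Cor 7.1a p.87–88] ("each of the results in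
this chapter holds both in real spaces and in rational spaces") in pointwise form, proved by the same `ℚ`-basis trick as
`mem_span_ratCast_of_forall_sum_mul_nonneg` with a rational box in place of a rational spanning set. -/
theorem mem_convexHull_ratCast_of_forall_sum_mul_nonneg {ι J : Type*} [Fintype ι] [Finite J] (a : J → ι → ℚ)
    (r : ι → ℝ) (hr : ∀ j, 0 ≤ ∑ i, (a j i : ℝ) * r i) :
    r ∈ convexHull ℝ
      {v : ι → ℝ | ∃ q : ι → ℚ, (∀ j, 0 ≤ ∑ i, a j i * q i) ∧ v = fun i => (q i : ℝ)} := by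
  classical
  set C : Set (ι → ℝ) := {v : ι → ℝ | ∃ q : ι → ℚ, (∀ j, 0 ≤ ∑ i, a j i * q i) ∧ v = fun i => (q i : ℝ)}
    with hC
  -- as in `mem_span_ratCast_of_forall_sum_mul_nonneg`: a `ℚ`-basis `w` of `span_ℚ {r i}`, coordinates `lam`,
  -- the linear map `V`, the forms `S`, the dichotomy, the open set `U ∋ w`
  set W : Submodule ℚ ℝ := Submodule.span ℚ (Set.range r) with hW
  haveI : Module.Finite ℚ W := Module.Finite.span_of_finite ℚ (Set.finite_range r)
  set m : ℕ := Module.finrank ℚ W with hm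
  let b : Module.Basis (Fin m) ℚ W := Module.finBasis ℚ W
  let w : Fin m → ℝ := fun k => (b k : ℝ)
  have hwli : LinearIndependent ℚ w := b.linearIndependent.map' W.subtype (Submodule.ker_subtype W)
  let ri : ι → W := fun i => ⟨r i, Submodule.subset_span ⟨i, rfl⟩⟩
  let lam : ι → Fin m → ℚ := fun i k => b.repr (ri i) k
  have hri : ∀ i, r i = ∑ k, (lam i k : ℝ) * w k := by
    intro i
    have h := congrArg Subtype.val (b.sum_repr (ri i))
    rw [Submodule.coe_sum] at h
    simp only [Submodule.coe_smul, Rat.smul_def] at h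
    exact h.symm
  let M : Matrix ι (Fin m) ℝ := fun i k => (lam i k : ℝ)
  let V : (Fin m → ℝ) →ₗ[ℝ] (ι → ℝ) := Matrix.mulVecLin M
  have hV : ∀ u : Fin m → ℝ, V u = fun i => ∑ k, (lam i k : ℝ) * u k := fun u => rfl
  have hVw : V w = r := by rw [hV]; funext i; exact (hri i).symm
  let S : J → Fin m → ℚ := fun j k => ∑ i, a j i * lam i k
  have hsum : ∀ (j : J) (u : Fin m → ℝ), ∑ i, (a j i : ℝ) * (V u) i = ∑ k, (S j k : ℝ) * u k := by
    intro j u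
    rw [hV]
    show ∑ i, (a j i : ℝ) * (∑ k, (lam i k : ℝ) * u k) = ∑ k, ((∑ i, a j i * lam i k : ℚ) : ℝ) * u k
    push_cast
    simp only [Finset.mul_sum, Finset.sum_mul, mul_assoc]
    exact Finset.sum_comm
  have hsumQ : ∀ (j : J) (u : Fin m → ℚ), ∑ i, a j i * (∑ k, lam i k * u k) = ∑ k, S j k * u k := by
    intro j u
    show ∑ i, a j i * (∑ k, lam i k * u k) = ∑ k, (∑ i, a j i * lam i k) * u k
    simp only [Finset.mul_sum, Finset.sum_mul, mul_assoc]
    exact Finset.sum_comm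
  have hdich : ∀ j, (∀ k, S j k = 0) ∨ 0 < ∑ k, (S j k : ℝ) * w k := by
    intro j
    have h0 : 0 ≤ ∑ k, (S j k : ℝ) * w k := by rw [← hsum j w, hVw]; exact hr j
    rcases h0.lt_or_eq with hlt | heq
    · exact Or.inr hlt
    · exact Or.inl (eq_zero_of_sum_ratCast_mul_eq_zero hwli (S j) heq.symm)
  let U : Set (Fin m → ℝ) := {u | ∀ j, ¬ (∀ k, S j k = 0) → 0 < ∑ k, (S j k : ℝ) * u k}
  have hUopen : IsOpen U := by
    have hU' : U = ⋂ j, {u : Fin m → ℝ | ¬ (∀ k, S j k = 0) → 0 < ∑ k, (S j k : ℝ) * u k} := by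
      ext u; simp only [Set.mem_iInter, Set.mem_setOf_eq, U]
    rw [hU']
    refine isOpen_iInter_of_finite fun j => ?_
    by_cases hj : ∀ k, S j k = 0
    · have : {u : Fin m → ℝ | ¬ (∀ k, S j k = 0) → 0 < ∑ k, (S j k : ℝ) * u k} = Set.univ :=
        Set.eq_univ_of_forall fun u h => (h hj).elim
      rw [this]; exact isOpen_univ
    · have : {u : Fin m → ℝ | ¬ (∀ k, S j k = 0) → 0 < ∑ k, (S j k : ℝ) * u k} =
          {u | 0 < ∑ k, (S j k : ℝ) * u k} := by
        ext u; simp only [Set.mem_setOf_eq]; exact ⟨fun h => h hj, fun h _ => h⟩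
      rw [this]
      exact isOpen_lt continuous_const (by fun_prop)
  have hwU : w ∈ U := fun j hj => (hdich j).resolve_left hj
  have himage : ∀ v ∈ {v : Fin m → ℝ | v ∈ U ∧ ∃ u : Fin m → ℚ, v = fun k => (u k : ℝ)}, V v ∈ C := by
    rintro _ ⟨hvU, u, rfl⟩
    refine ⟨fun i => ∑ k, lam i k * u k, fun j => ?_, ?_⟩
    · rw [hsumQ]
      rcases hdich j with hj | hj
      · simp only [hj, zero_mul, Finset.sum_const_zero, le_refl]
      · have hpos := hvU j (fun hall => ?_)
        · have : (0 : ℝ) < ((∑ k, S j k * u k : ℚ) : ℝ) := by push_cast; exact hpos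
          exact le_of_lt (by exact_mod_cast this)
        · simp only [hall, Rat.cast_zero, zero_mul, Finset.sum_const_zero, lt_self_iff_false] at hj
    · rw [hV]; funext i; push_cast; rfl
  -- the convex-hull step: `w` is a convex combination of rational points of `U`; apply the LINEAR map `V`
  have hwhull := mem_convexHull_ratCast_of_isOpen hUopen hwU
  rw [← hVw]
  have hmap : V w ∈ V '' convexHull ℝ {v : Fin m → ℝ | v ∈ U ∧ ∃ u : Fin m → ℚ, v = fun k => (u k : ℝ)} :=
    Set.mem_image_of_mem _ hwhull
  rw [LinearMap.image_convexHull] at hmap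
  refine convexHull_mono ?_ hmap
  rintro _ ⟨v, hv, rfl⟩
  exact himage v hv

end Literature.Analysis.Convex.RationalCone
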